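import Literature.AnabelianGeometry.EtaleTheta.DoubleUnderlineTower
import Literature.AnabelianGeometry.EtaleTheta.Discharge.Sec2ClassTwoCommutators

/-!
# [EtTh] §2 over §1: the GEOMETRIC degree of `X̲̲ → X̲` — `[Δ^tp_X̲ : Δ^tp_X̲̲] = l` in the §1 model

Mochizuki, *The étale theta function …* [EtTh], Publ. RIMS **45** (2009), §2, Prop. 2.2 (ii), PRIMS PDF p. 37
("the 'geometric portion' `Δ_X̲̲` of `Π_X̲̲` maps isomorphically onto `Δ̄^ell_X̲` [hence is a cyclic group of order `l`],
i.e., we have `Δ̄_X̲̲ = Im(s_ι)`, `Δ̄_X̲ = Δ̄_X̲̲ · Δ̄_Θ`" — so `[Δ_X̲ : Δ_X̲̲] = l`) and Rmk. 2.3.1 p. 38 ("extracting two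
copies of `ℤ/lℤ`") [cite: MochizukiEtTh2009, Prop 2.2 (ii) p.37]. PROOF-ONLY companion (0 definitions) of
`DoubleUnderline.lean` / `DoubleUnderlineTower.lean` (cell abc-iut, layer L2; seat abc-iut-L2-t8, the `X̲̲`-adapter owner;
written for abc-iut-L6-t19's ±-tower model question of 2026-08-26 03:48Z: "`deltaHat_index = [Δ_X̲ : Δ_X̲̲] = l`").

For the §1 root `D : ThetaSetting p`, étale theta data `E` and a choice `C : E.DoubleUnderline l` of `X̲̲`
(`Π^tp_X̲̲ = C.Huu`; `Π^tp_X̲ = D.GtpXu l = toZ⁻¹(l·Z)`, abc-iut-L2-t7's `SingleUnderline.lean`), with the TEMPERED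
geometric groups `Δ^tp_X̲ := Π^tp_X̲ ∩ Δ^tp_X`, `Δ^tp_X̲̲ := Π^tp_X̲̲ ∩ Δ^tp_X`:

* `Huu_sup_deltaXu` — `Π^tp_X̲̲ · Δ^tp_X̲ = Π^tp_X̲` (both `Π^tp_X̲̲ ⊇ Π^tp_Ÿ̲̲` and `Π^tp_X̲` map ONTO `G_K`: field
  `map_aug_Ydduu`, "`G_K ≅ Π_X̲̲/Δ_X̲̲`", Prop. 2.2 (iii));
* **`relIndex_Huu_deltaXu`** — `[Δ^tp_X̲ : Δ^tp_X̲ ∩ Π^tp_X̲̲] = l`: by the second isomorphism theorem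
  (`ClassTwo.relIndex_sup_eq_relIndex`, `Δ^tp_X̲ ⊴ Π^tp_X`) this index is `[Π^tp_X̲ : Π^tp_X̲̲] = l` (abc-iut-L2-t7's
  `relIndex_Huu_GtpXu`, itself from the field "`Y̲̲ → Y` of degree `l`");
* **`relIndex_deltaXuu_deltaXu`** — the same with `Δ^tp_X̲̲ = Π^tp_X̲̲ ∩ Δ^tp_X` in the first slot:
  `[Δ^tp_X̲ : Δ^tp_X̲̲] = l`;
* `relIndex_deltaXu_deltaTemp`, `relIndex_deltaXuu_deltaTemp` — `[Δ^tp_X : Δ^tp_X̲] = l` (abc-iut-L2-t7's `index_GtpXu` +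
  `deltaTemp_sup_GtpXu`, i.e. the root field `toZ_delta_surjective`) and hence `[Δ^tp_X : Δ^tp_X̲̲] = l²` ("two copies of
  `ℤ/lℤ`", geometric side).

What is NOT here (and not derivable from `DoubleUnderline`'s fields, which see `Π^tp_X̲̲` only through images and
indices): NORMALITY of `Π^tp_X̲̲` in `Π^tp_X̲` — in print `X̲̲ → X̲` is Galois exactly when `G_K` acts trivially on
`Δ̄_Θ ≅ μ_l`, i.e. `μ_l ⊆ K` (automatic in [IUTchI] Def. 3.1 (c)'s situation, not in [EtTh] §2's); the profinite
form `[Δ_X̲ : Δ_X̲̲] = l` (closures in `Π_X`) is a completion-transfer left to the consumer. HONEST FRAMING: [EtTh] is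
refereed; the structures are data quoting print, asserted to exist for no curve here; no side is taken on
[IUTchIII] Cor. 3.12.
-/

noncomputable section

namespace Literature.AnabelianGeometry.EtaleTheta

open Literature.AnabelianGeometry.SemiGraphs

namespace ThetaSetting

variable {p : ℕ} [Fact p.Prime] {D : ThetaSetting p} (l : ℕ)

/-- `Δ^tp_X̲ = Π^tp_X̲ ∩ Δ^tp_X` is normal in `Π^tp_X` (`Π^tp_X̲ ⊴ Π^tp_X`, `Δ^tp_X = Ker` of the augmentation).
[cite: MochizukiEtTh2009, Rmk 2.1.1 p.36] -/
theorem deltaXu_normal : (D.GtpXu l ⊓ D.DeltaTemp).Normal := by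
  haveI : D.DeltaTemp.Normal := inferInstanceAs D.aug.toMonoidHom.ker.Normal
  infer_instance

/-- `[Δ^tp_X : Δ^tp_X̲] = l` on the geometric side of `X̲ → X` ("the restricted map `Δ̄^ell_X → Q` is still
surjective", Def. 2.1 p. 36: `toZ` restricted to `Δ^tp_X` is onto `Z`, root field `toZ_delta_surjective`) — from
abc-iut-L2-t7's `index_GtpXu` and `deltaTemp_sup_GtpXu` (`Δ^tp_X · Π^tp_X̲ = Π^tp_X`). [cite: MochizukiEtTh2009, Def 2.1 p.36] -/
theorem relIndex_deltaXu_deltaTemp : (D.GtpXu l ⊓ D.DeltaTemp).relIndex D.DeltaTemp = l := by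
  haveI : D.DeltaTemp.Normal := inferInstanceAs D.aug.toMonoidHom.ker.Normal
  have hsup : D.GtpXu l ⊔ D.DeltaTemp = ⊤ := by rw [sup_comm]; exact D.deltaTemp_sup_GtpXu l
  rw [Subgroup.inf_relIndex_right, ← ClassTwo.relIndex_sup_eq_relIndex (D.GtpXu l) D.DeltaTemp, hsup,
    Subgroup.relIndex_top_right]
  exact D.index_GtpXu l

namespace EtaleThetaData.DoubleUnderline

variable {E : D.EtaleThetaData} {l} (C : E.DoubleUnderline l)

/-- Every element of `Π^tp_X̲` is congruent modulo `Π^tp_Ÿ̲̲ ⊆ Π^tp_X̲̲` to an element of `Δ^tp_X̲`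
(`Π^tp_Ÿ̲̲ ↠ G_K`, field `map_aug_Ydduu`). [cite: MochizukiEtTh2009, Prop 2.2 (iii) p.37] -/
theorem exists_mem_Huu_mul_mem_deltaXu {g : D.PiTemp} (hg : g ∈ D.GtpXu l) :
    ∃ k ∈ C.Huu, ∃ d ∈ D.GtpXu l ⊓ D.DeltaTemp, g = k * d := by
  have hmem : D.aug.toMonoidHom g ∈ (D.GtpYdd ⊓ C.Huu).map D.aug.toMonoidHom := by
    rw [C.map_aug_Ydduu]
    exact D.aug_mem_GK g
  obtain ⟨k, hk, hkg⟩ := hmem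
  have hkH : k ∈ C.Huu := (Subgroup.mem_inf.mp hk).2
  refine ⟨k, hkH, k⁻¹ * g, Subgroup.mem_inf.mpr ⟨?_, ?_⟩, by group⟩
  · exact Subgroup.mul_mem _ (Subgroup.inv_mem _ (C.Huu_le_GtpXu hkH)) hg
  · change k⁻¹ * g ∈ D.aug.toMonoidHom.ker
    rw [MonoidHom.mem_ker, map_mul, map_inv, hkg, inv_mul_cancel]

/-- **`Π^tp_X̲̲ · Δ^tp_X̲ = Π^tp_X̲`** (geometric connectedness of `X̲̲ → X̲`: both map onto `G_K`).
[cite: MochizukiEtTh2009, Prop 2.2 (iii) p.37] -/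
theorem Huu_sup_deltaXu : C.Huu ⊔ (D.GtpXu l ⊓ D.DeltaTemp) = D.GtpXu l := by
  refine le_antisymm (sup_le C.Huu_le_GtpXu inf_le_left) fun g hg => ?_
  obtain ⟨k, hk, d, hd, rfl⟩ := C.exists_mem_Huu_mul_mem_deltaXu hg
  exact Subgroup.mul_mem _ (Subgroup.mem_sup_left hk) (Subgroup.mem_sup_right hd)

/-- **`[Δ^tp_X̲ : Δ^tp_X̲ ∩ Π^tp_X̲̲] = l`** — the GEOMETRIC degree of `X̲̲ → X̲` ("`Δ̄_X̲ = Δ̄_X̲̲ · Δ̄_Θ`", `Δ̄_X̲̲`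
cyclic of order `l`, Prop. 2.2 (ii)): by the second isomorphism theorem (`Δ^tp_X̲ ⊴ Π^tp_X`) it equals
`[Π^tp_X̲̲ · Δ^tp_X̲ : Π^tp_X̲̲] = [Π^tp_X̲ : Π^tp_X̲̲] = l` (abc-iut-L2-t7's `relIndex_Huu_GtpXu`).
[cite: MochizukiEtTh2009, Prop 2.2 (ii) p.37] -/
theorem relIndex_Huu_deltaXu : C.Huu.relIndex (D.GtpXu l ⊓ D.DeltaTemp) = l := by
  haveI := deltaXu_normal (D := D) l
  rw [← ClassTwo.relIndex_sup_eq_relIndex C.Huu (D.GtpXu l ⊓ D.DeltaTemp), C.Huu_sup_deltaXu]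
  exact C.relIndex_Huu_GtpXu

/-- **`[Δ^tp_X̲ : Δ^tp_X̲̲] = l`** with `Δ^tp_X̲̲ := Π^tp_X̲̲ ∩ Δ^tp_X` (the same index: a relative index only sees the
intersection with the ambient group). [cite: MochizukiEtTh2009, Prop 2.2 (ii) p.37] -/
theorem relIndex_deltaXuu_deltaXu : (C.Huu ⊓ D.DeltaTemp).relIndex (D.GtpXu l ⊓ D.DeltaTemp) = l := by
  have h : (C.Huu ⊓ D.DeltaTemp).subgroupOf (D.GtpXu l ⊓ D.DeltaTemp) =
      C.Huu.subgroupOf (D.GtpXu l ⊓ D.DeltaTemp) := by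
    ext x
    simp only [Subgroup.mem_subgroupOf, Subgroup.mem_inf]
    exact ⟨fun hx => hx.1, fun hx => ⟨hx, (Subgroup.mem_inf.mp x.2).2⟩⟩
  rw [Subgroup.relIndex, h]
  exact C.relIndex_Huu_deltaXu

/-- **`[Δ^tp_X : Δ^tp_X̲̲] = l²`** on the geometric side ("extracting two copies of `ℤ/lℤ`", Rmk. 2.3.1):
`[Δ^tp_X : Δ^tp_X̲] · [Δ^tp_X̲ : Δ^tp_X̲̲] = l · l`. [cite: MochizukiEtTh2009, Rmk 2.3.1 p.38] -/
theorem relIndex_deltaXuu_deltaTemp : (C.Huu ⊓ D.DeltaTemp).relIndex D.DeltaTemp = l ^ 2 := by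
  have h1 : (C.Huu ⊓ D.DeltaTemp).relIndex (D.GtpXu l ⊓ D.DeltaTemp) *
      (D.GtpXu l ⊓ D.DeltaTemp).relIndex D.DeltaTemp = (C.Huu ⊓ D.DeltaTemp).relIndex D.DeltaTemp :=
    Subgroup.relIndex_mul_relIndex (C.Huu ⊓ D.DeltaTemp) (D.GtpXu l ⊓ D.DeltaTemp) D.DeltaTemp
      (inf_le_inf_right D.DeltaTemp C.Huu_le_GtpXu) inf_le_right
  rw [C.relIndex_deltaXuu_deltaXu, relIndex_deltaXu_deltaTemp (D := D) l] at h1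
  rw [← h1, sq]

end EtaleThetaData.DoubleUnderline

end ThetaSetting

end Literature.AnabelianGeometry.EtaleTheta
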